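import Summits.AnomalousDissipation.AnomalousDissipation.Theorems.MomentParityQuarticGateAtomicMeasure
import Summits.AnomalousDissipation.AnomalousDissipation.Theorems.MomentParityQuarticGateAtomRows
import Summits.AnomalousDissipation.AnomalousDissipation.Theorems.MomentParityQuarticGateModeCalculus
import Summits.AnomalousDissipation.AnomalousDissipation.Theorems.CubicParityLoud.Negative.Clauses
import Summits.AnomalousDissipation.AnomalousDissipation.Theorems.MomentParityCubicParityLoudBalancedMenuAverages

/-!
# The random-sign atom cloud: rows of the uniform law in Fourier variables

Helper file for stub S5 (`stub_balancedMenu`), line `farkas-split-menu`, crux `MomentParity.CubicParityLoud`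
(stmt-AnomalousDissipation-11465). Given a level `N`, a viscosity `ν`, a smooth force `f`, a conjugate-symmetric
transversal MEAN FLOW family `m` with zero self-stress and finitely many conjugate-symmetric transversal PIECES
`Aᵢ` balancing the residual force, `∑ᵢ convectionCoeff Aᵢ Aᵢ = f̂ - 4π²ν|κ|² m̂` on the punctured ball, the
UNIFORM LAW on the `2^{#ι}` atoms `û(s) = m + ∑ᵢ ε(sᵢ) Aᵢ` (`s : ι → Bool`) is a probability law on `H`
carried by level-`N` fields, `‖u‖³` integrable, EVERY LINEAR ROW VANISHES, and its energy / helicity drifts,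
mean energy and mean dissipation are explicit finite sums (`atoms_measure`; ingredients: `…QuarticGateAtomRows`,
`…QuarticGateAtomicMeasure`, `…BalancedMenuAverages`).
-/

noncomputable section

namespace Summit.AnomalousDissipation.AnomalousDissipation.Theorems.MomentParityCubicParityLoud

open MeasureTheory Finset Complex UnitAddTorus
open scoped ComplexConjugate ENNReal InnerProductSpace RealInnerProductSpace
open Literature.Analysis.FunctionSpaces Literature.Analysis.FluidPDE
open Summit.AnomalousDissipation.AnomalousDissipation.Theorems.MomentParityQuarticGate
open Summit.AnomalousDissipation.AnomalousDissipation.Theorems.CubicParityLoud.Negative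

set_option linter.dupNamespace false

/-! ## Linear and bilinear coefficient functionals -/

section Functionals

variable {S : Finset (Fin 3 → ℤ)}

/-- Additivity of `c ↦ ∑_k Re⟪a k, T_k (c k)⟫` for additive `T_k`. [folklore] -/
theorem functional₁_add (a : (Fin 3 → ℤ) → EuclideanSpace ℂ (Fin 3))
    (T : (Fin 3 → ℤ) → EuclideanSpace ℂ (Fin 3) → EuclideanSpace ℂ (Fin 3))
    (hT : ∀ k x y, T k (x + y) = T k x + T k y) (c c' : (Fin 3 → ℤ) → EuclideanSpace ℂ (Fin 3)) :
    ∑ k ∈ S, (inner ℂ (a k) (T k ((c + c') k))).re =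
      ∑ k ∈ S, (inner ℂ (a k) (T k (c k))).re + ∑ k ∈ S, (inner ℂ (a k) (T k (c' k))).re := by
  rw [← Finset.sum_add_distrib]
  exact Finset.sum_congr rfl fun k _ => by rw [Pi.add_apply, hT, inner_add_right, Complex.add_re]

/-- Real homogeneity of `c ↦ ∑_k Re⟪a k, T_k (c k)⟫` for real-homogeneous `T_k`. [folklore] -/
theorem functional₁_smul (a : (Fin 3 → ℤ) → EuclideanSpace ℂ (Fin 3))
    (T : (Fin 3 → ℤ) → EuclideanSpace ℂ (Fin 3) → EuclideanSpace ℂ (Fin 3))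
    (hT : ∀ k (r : ℝ) x, T k (r • x) = r • T k x) (r : ℝ) (c : (Fin 3 → ℤ) → EuclideanSpace ℂ (Fin 3)) :
    ∑ k ∈ S, (inner ℂ (a k) (T k ((r • c) k))).re = r * ∑ k ∈ S, (inner ℂ (a k) (T k (c k))).re := by
  rw [Finset.mul_sum]
  exact Finset.sum_congr rfl fun k _ => by rw [Pi.smul_apply, hT, ← Complex.coe_smul, inner_smul_right, Complex.re_ofReal_mul]

/-- Additivity in the first slot of `(c, c') ↦ ∑_k Re⟪T_k (c k), T'_k (c' k)⟫`. [folklore] -/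
theorem functional₂_add_left (T T' : (Fin 3 → ℤ) → EuclideanSpace ℂ (Fin 3) → EuclideanSpace ℂ (Fin 3))
    (hT : ∀ k x y, T k (x + y) = T k x + T k y) (c c' d : (Fin 3 → ℤ) → EuclideanSpace ℂ (Fin 3)) :
    ∑ k ∈ S, (inner ℂ (T k ((c + c') k)) (T' k (d k))).re =
      ∑ k ∈ S, (inner ℂ (T k (c k)) (T' k (d k))).re + ∑ k ∈ S, (inner ℂ (T k (c' k)) (T' k (d k))).re := by
  rw [← Finset.sum_add_distrib]
  exact Finset.sum_congr rfl fun k _ => by rw [Pi.add_apply, hT, inner_add_left, Complex.add_re]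

/-- Real homogeneity in the first slot of `(c, c') ↦ ∑_k Re⟪T_k (c k), T'_k (c' k)⟫`. [folklore] -/
theorem functional₂_smul_left (T T' : (Fin 3 → ℤ) → EuclideanSpace ℂ (Fin 3) → EuclideanSpace ℂ (Fin 3))
    (hT : ∀ k (r : ℝ) x, T k (r • x) = r • T k x) (r : ℝ) (c d : (Fin 3 → ℤ) → EuclideanSpace ℂ (Fin 3)) :
    ∑ k ∈ S, (inner ℂ (T k ((r • c) k)) (T' k (d k))).re = r * ∑ k ∈ S, (inner ℂ (T k (c k)) (T' k (d k))).re := by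
  rw [Finset.mul_sum]
  refine Finset.sum_congr rfl fun k _ => ?_
  rw [Pi.smul_apply, hT, ← Complex.coe_smul, inner_smul_left, Complex.conj_ofReal, Complex.re_ofReal_mul]

/-- Additivity in the second slot of `(c, c') ↦ ∑_k Re⟪T_k (c k), T'_k (c' k)⟫`. [folklore] -/
theorem functional₂_add_right (T T' : (Fin 3 → ℤ) → EuclideanSpace ℂ (Fin 3) → EuclideanSpace ℂ (Fin 3))
    (hT' : ∀ k x y, T' k (x + y) = T' k x + T' k y) (c d d' : (Fin 3 → ℤ) → EuclideanSpace ℂ (Fin 3)) :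
    ∑ k ∈ S, (inner ℂ (T k (c k)) (T' k ((d + d') k))).re =
      ∑ k ∈ S, (inner ℂ (T k (c k)) (T' k (d k))).re + ∑ k ∈ S, (inner ℂ (T k (c k)) (T' k (d' k))).re :=
  functional₁_add (fun k => T k (c k)) T' hT' d d'

/-- Real homogeneity in the second slot of `(c, c') ↦ ∑_k Re⟪T_k (c k), T'_k (c' k)⟫`. [folklore] -/
theorem functional₂_smul_right (T T' : (Fin 3 → ℤ) → EuclideanSpace ℂ (Fin 3) → EuclideanSpace ℂ (Fin 3))
    (hT' : ∀ k (r : ℝ) x, T' k (r • x) = r • T' k x) (r : ℝ) (c d : (Fin 3 → ℤ) → EuclideanSpace ℂ (Fin 3)) :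
    ∑ k ∈ S, (inner ℂ (T k (c k)) (T' k ((r • d) k))).re = r * ∑ k ∈ S, (inner ℂ (T k (c k)) (T' k (d k))).re :=
  functional₁_smul (fun k => T k (c k)) T' hT' r d

/-- Real scalar multiples of a coefficient family are complex scalar multiples. [folklore] -/
theorem real_smul_family (r : ℝ) (c : (Fin 3 → ℤ) → EuclideanSpace ℂ (Fin 3)) :
    r • c = ((r : ℂ) • c : (Fin 3 → ℤ) → EuclideanSpace ℂ (Fin 3)) := by
  funext k
  rw [Pi.smul_apply, Pi.smul_apply, Complex.coe_smul]

/-- Additivity in the first slot of the Reynolds-stress row `(c, c') ↦ ∑_k Re⟪convectionCoeff c c' k, ĝ k⟫`.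
[folklore] -/
theorem stressRow_add_left (g c c' d : (Fin 3 → ℤ) → EuclideanSpace ℂ (Fin 3)) :
    ∑ k ∈ S, (inner ℂ (Torus.convectionCoeff S (c + c') d k) (g k)).re =
      ∑ k ∈ S, (inner ℂ (Torus.convectionCoeff S c d k) (g k)).re +
        ∑ k ∈ S, (inner ℂ (Torus.convectionCoeff S c' d k) (g k)).re := by
  rw [← Finset.sum_add_distrib]
  exact Finset.sum_congr rfl fun k _ => by rw [Torus.convectionCoeff_add_left, inner_add_left, Complex.add_re]

/-- Additivity in the second slot of the Reynolds-stress row. [folklore] -/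
theorem stressRow_add_right (g c d d' : (Fin 3 → ℤ) → EuclideanSpace ℂ (Fin 3)) :
    ∑ k ∈ S, (inner ℂ (Torus.convectionCoeff S c (d + d') k) (g k)).re =
      ∑ k ∈ S, (inner ℂ (Torus.convectionCoeff S c d k) (g k)).re +
        ∑ k ∈ S, (inner ℂ (Torus.convectionCoeff S c d' k) (g k)).re := by
  rw [← Finset.sum_add_distrib]
  exact Finset.sum_congr rfl fun k _ => by rw [Torus.convectionCoeff_add_right, inner_add_left, Complex.add_re]

/-- Real homogeneity in the first slot of the Reynolds-stress row. [folklore] -/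
theorem stressRow_smul_left (g : (Fin 3 → ℤ) → EuclideanSpace ℂ (Fin 3)) (r : ℝ)
    (c d : (Fin 3 → ℤ) → EuclideanSpace ℂ (Fin 3)) :
    ∑ k ∈ S, (inner ℂ (Torus.convectionCoeff S (r • c) d k) (g k)).re =
      r * ∑ k ∈ S, (inner ℂ (Torus.convectionCoeff S c d k) (g k)).re := by
  rw [Finset.mul_sum, real_smul_family]
  exact Finset.sum_congr rfl fun k _ => by
    rw [Torus.convectionCoeff_smul_left, inner_smul_left, Complex.conj_ofReal, Complex.re_ofReal_mul]

/-- Real homogeneity in the second slot of the Reynolds-stress row. [folklore] -/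
theorem stressRow_smul_right (g : (Fin 3 → ℤ) → EuclideanSpace ℂ (Fin 3)) (r : ℝ)
    (c d : (Fin 3 → ℤ) → EuclideanSpace ℂ (Fin 3)) :
    ∑ k ∈ S, (inner ℂ (Torus.convectionCoeff S c (r • d) k) (g k)).re =
      r * ∑ k ∈ S, (inner ℂ (Torus.convectionCoeff S c d k) (g k)).re := by
  rw [Finset.mul_sum, real_smul_family]
  exact Finset.sum_congr rfl fun k _ => by
    rw [Torus.convectionCoeff_smul_right, inner_smul_left, Complex.conj_ofReal, Complex.re_ofReal_mul]

/-- The curl symbol at a single frequency is additive in the amplitude. [folklore] -/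
theorem curlCoeff_const_add (k : Fin 3 → ℤ) (x y : EuclideanSpace ℂ (Fin 3)) :
    IntermittentBeltrami.curlCoeff (fun _ => x + y) k =
      IntermittentBeltrami.curlCoeff (fun _ => x) k + IntermittentBeltrami.curlCoeff (fun _ => y) k :=
  curlCoeff_add (fun _ => x) (fun _ => y) k

/-- The curl symbol at a single frequency is real homogeneous in the amplitude. [folklore] -/
theorem curlCoeff_const_smul (k : Fin 3 → ℤ) (r : ℝ) (x : EuclideanSpace ℂ (Fin 3)) :
    IntermittentBeltrami.curlCoeff (fun _ => r • x) k = r • IntermittentBeltrami.curlCoeff (fun _ => x) k :=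
  curlCoeff_real_smul r (fun _ => x) k

/-- The diagonal of the enstrophy form: `∑_k Re⟪c k, |k|² c k⟫ = ∑_k |k|² ‖c k‖²`. [folklore] -/
theorem enstrophyForm_diag (c : (Fin 3 → ℤ) → EuclideanSpace ℂ (Fin 3)) :
    ∑ k ∈ S, (inner ℂ (c k) ((Torus.freqNormSq k : ℝ) • c k)).re = ∑ k ∈ S, Torus.freqNormSq k * ‖c k‖ ^ 2 := by
  refine Finset.sum_congr rfl fun k _ => ?_
  rw [← Complex.coe_smul, inner_smul_right, Complex.re_ofReal_mul, inner_self_eq_norm_sq_to_K]; norm_cast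

/-- The diagonal of the energy form: `∑_k Re⟪c k, c k⟫ = ∑_k ‖c k‖²`. [folklore] -/
theorem energyForm_diag (c : (Fin 3 → ℤ) → EuclideanSpace ℂ (Fin 3)) :
    ∑ k ∈ S, (inner ℂ (c k) (c k)).re = ∑ k ∈ S, ‖c k‖ ^ 2 := by
  exact Finset.sum_congr rfl fun k _ => by rw [inner_self_eq_norm_sq_to_K]; norm_cast

end Functionals

/-! ## The uniform law on the random-sign atoms and its rows -/

section Atoms

variable {ι : Type*} [Fintype ι] [DecidableEq ι]

/-- **THE ATOM CLOUD.** For a level `N`, a viscosity `ν`, a smooth force `f`, a conjugate-symmetric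
transversal mean-flow family `m` with `convectionCoeff m m = 0`, and conjugate-symmetric
transversal pieces `Aᵢ` (`i ∈ ι` finite) balancing the residual force on the punctured ball,
`∑ᵢ convectionCoeff Aᵢ Aᵢ κ = f̂ κ - (4π²ν|κ|²) • m κ`, the uniform law on the atoms
`realTrigPoly S (m + ∑ᵢ ε(sᵢ) Aᵢ)`, `s : ι → Bool`, is a probability law on `H` carried by
level-`N` fields with `‖u‖³` integrable, whose LINEAR ROWS all vanish, whose ENERGY and HELICITY
drifts, mean energy and mean dissipation are the displayed finite sums. [folklore] -/
theorem atoms_measure (N : ℕ) (ν : ℝ) {f : T3 → R3} (hf : Torus.IsSmooth f)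
    (m : (Fin 3 → ℤ) → EuclideanSpace ℂ (Fin 3)) (A : ι → (Fin 3 → ℤ) → EuclideanSpace ℂ (Fin 3))
    (hm : Torus.IsConjSymm m) (hmT : Torus.IsTransversal ((Torus.freqBall N).erase 0) m)
    (hA : ∀ i, Torus.IsConjSymm (A i)) (hAT : ∀ i, Torus.IsTransversal ((Torus.freqBall N).erase 0) (A i))
    (hmm : Torus.convectionCoeff ((Torus.freqBall N).erase 0) m m = 0)
    (hlin : ∀ κ ∈ (Torus.freqBall N).erase 0,
      ∑ i, Torus.convectionCoeff ((Torus.freqBall N).erase 0) (A i) (A i) κ =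
        mFourierCoeff (EuclideanSpace.complexify ∘ f) κ -
          (((4 * Real.pi ^ 2 * Torus.freqNormSq κ : ℝ) : ℂ) * (ν : ℂ)) • m κ) :
    ∃ μ : Measure H3,
      IsProbabilityMeasure μ ∧ (∀ᵐ u ∂μ, IsLevel N u) ∧ Integrable (fun u : H3 => ‖u‖ ^ 3) μ ∧
      (∀ g : T3 → R3, IsBandTest N g →
          Integrable (fun u : H3 => Torus.nsGeneratorPairing ν f u g) μ ∧
            ∫ u, Torus.nsGeneratorPairing ν f u g ∂μ = 0) ∧
      (Integrable (fun u : H3 => Torus.nsGeneratorPairing ν f u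
          (Torus.fourierTruncate N ((u : L2T3) : T3 → R3))) μ ∧
        ∫ u, Torus.nsGeneratorPairing ν f u (Torus.fourierTruncate N ((u : L2T3) : T3 → R3)) ∂μ =
          (∑ κ ∈ (Torus.freqBall N).erase 0,
              (inner ℂ (mFourierCoeff (EuclideanSpace.complexify ∘ f) κ) (m κ)).re) -
            ν * (4 * Real.pi ^ 2 * ((∑ κ ∈ (Torus.freqBall N).erase 0, Torus.freqNormSq κ * ‖m κ‖ ^ 2) +
              ∑ i, ∑ κ ∈ (Torus.freqBall N).erase 0, Torus.freqNormSq κ * ‖A i κ‖ ^ 2))) ∧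
      (Integrable (fun u : H3 => Torus.nsGeneratorPairing ν f u
          (BDSV.curl (Torus.fourierTruncate N ((u : L2T3) : T3 → R3)))) μ ∧
        ∫ u, Torus.nsGeneratorPairing ν f u (BDSV.curl (Torus.fourierTruncate N ((u : L2T3) : T3 → R3))) ∂μ =
          (∑ κ ∈ (Torus.freqBall N).erase 0,
              (inner ℂ (mFourierCoeff (EuclideanSpace.complexify ∘ f) κ) (IntermittentBeltrami.curlCoeff m κ)).re) +
            ν * ((∑ κ ∈ (Torus.freqBall N).erase 0,
                (inner ℂ (m κ) (-((((4 * Real.pi ^ 2 * Torus.freqNormSq κ : ℝ) : ℂ)) •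
                  IntermittentBeltrami.curlCoeff m κ))).re) +
              ∑ i, ∑ κ ∈ (Torus.freqBall N).erase 0,
                (inner ℂ (A i κ) (-((((4 * Real.pi ^ 2 * Torus.freqNormSq κ : ℝ) : ℂ)) •
                  IntermittentBeltrami.curlCoeff (A i) κ))).re)) ∧
      Torus.ensembleEnergy μ = (∑ κ ∈ (Torus.freqBall N).erase 0, ‖m κ‖ ^ 2) +
          ∑ i, ∑ κ ∈ (Torus.freqBall N).erase 0, ‖A i κ‖ ^ 2 ∧
      Torus.ensembleDissipation ν μ =
        ν * (4 * Real.pi ^ 2 * ((∑ κ ∈ (Torus.freqBall N).erase 0, Torus.freqNormSq κ * ‖m κ‖ ^ 2) +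
          ∑ i, ∑ κ ∈ (Torus.freqBall N).erase 0, Torus.freqNormSq κ * ‖A i κ‖ ^ 2)) := by
  -- the atoms
  have hc : ∀ s : ι → Bool, Torus.IsConjSymm (m + ∑ i, (if s i then (1 : ℝ) else -1) • A i) :=
    isConjSymm_superposition hm hA
  have hcT : ∀ s : ι → Bool,
      Torus.IsTransversal ((Torus.freqBall N).erase 0) (m + ∑ i, (if s i then (1 : ℝ) else -1) • A i) :=
    isTransversal_superposition _ hmT hAT
  choose U hU using fun s : ι → Bool =>
    exists_energySpace_coe_ae_eq_realTrigPoly N (m + ∑ i, (if s i then (1 : ℝ) else -1) • A i) (hcT s)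
  haveI : Nonempty (ι → Bool) := ⟨fun _ => true⟩
  have hfi : Integrable f volume := hf.integrable
  have hcard : (Fintype.card (ι → Bool) : ℝ) ≠ 0 := by exact_mod_cast Fintype.card_ne_zero
  -- sign averages of the energy, enstrophy and helicity weights and of the two linear functionals
  have hLinE : (Fintype.card (ι → Bool) : ℝ)⁻¹ * ∑ s : ι → Bool, ∑ k ∈ (Torus.freqBall N).erase 0,
      (inner ℂ (mFourierCoeff (EuclideanSpace.complexify ∘ f) k) ((m + ∑ i, (if s i then (1 : ℝ) else -1) • A i) k)).re =
      ∑ k ∈ (Torus.freqBall N).erase 0, (inner ℂ (mFourierCoeff (EuclideanSpace.complexify ∘ f) k) (m k)).re := by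
    refine average_sign_of_linear (fun c : (Fin 3 → ℤ) → EuclideanSpace ℂ (Fin 3) =>
        ∑ k ∈ (Torus.freqBall N).erase 0, (inner ℂ (mFourierCoeff (EuclideanSpace.complexify ∘ f) k) (c k)).re)
      (fun x y => ?_) (fun r x => ?_) m A
    · exact functional₁_add (fun k => mFourierCoeff (EuclideanSpace.complexify ∘ f) k) (fun _ v => v)
        (fun _ _ _ => rfl) x y
    · exact functional₁_smul (fun k => mFourierCoeff (EuclideanSpace.complexify ∘ f) k) (fun _ v => v)
        (fun _ _ _ => rfl) r x
  have hZ : (Fintype.card (ι → Bool) : ℝ)⁻¹ * ∑ s : ι → Bool, ∑ k ∈ (Torus.freqBall N).erase 0,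
      Torus.freqNormSq k * ‖(m + ∑ i, (if s i then (1 : ℝ) else -1) • A i) k‖ ^ 2 =
      (∑ k ∈ (Torus.freqBall N).erase 0, Torus.freqNormSq k * ‖m k‖ ^ 2) +
        ∑ i, ∑ k ∈ (Torus.freqBall N).erase 0, Torus.freqNormSq k * ‖A i k‖ ^ 2 := by
    have h : (Fintype.card (ι → Bool) : ℝ)⁻¹ * ∑ s : ι → Bool, ∑ k ∈ (Torus.freqBall N).erase 0,
        (inner ℂ ((m + ∑ i, (if s i then (1 : ℝ) else -1) • A i) k)
          ((Torus.freqNormSq k : ℝ) • (m + ∑ i, (if s i then (1 : ℝ) else -1) • A i) k)).re =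
        (∑ k ∈ (Torus.freqBall N).erase 0, (inner ℂ (m k) ((Torus.freqNormSq k : ℝ) • m k)).re) +
          ∑ i, ∑ k ∈ (Torus.freqBall N).erase 0, (inner ℂ (A i k) ((Torus.freqNormSq k : ℝ) • A i k)).re := by
      refine average_sign_of_bilinear (fun c c' : (Fin 3 → ℤ) → EuclideanSpace ℂ (Fin 3) =>
          ∑ k ∈ (Torus.freqBall N).erase 0, (inner ℂ (c k) ((Torus.freqNormSq k : ℝ) • c' k)).re)
        (fun x y z => ?_) (fun r x z => ?_) (fun x y z => ?_) (fun r x z => ?_) m A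
      · exact functional₂_add_left (fun _ v => v) (fun k v => (Torus.freqNormSq k : ℝ) • v) (fun _ _ _ => rfl) x y z
      · exact functional₂_smul_left (fun _ v => v) (fun k v => (Torus.freqNormSq k : ℝ) • v) (fun _ _ _ => rfl) r x z
      · exact functional₂_add_right (fun _ v => v) (fun k v => (Torus.freqNormSq k : ℝ) • v)
          (fun _ _ _ => smul_add _ _ _) x y z
      · exact functional₂_smul_right (fun _ v => v) (fun k v => (Torus.freqNormSq k : ℝ) • v)
          (fun _ _ _ => smul_comm _ _ _) r x z
    simpa only [enstrophyForm_diag] using h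
  have hEn : (Fintype.card (ι → Bool) : ℝ)⁻¹ * ∑ s : ι → Bool, ∑ k ∈ (Torus.freqBall N).erase 0,
      ‖(m + ∑ i, (if s i then (1 : ℝ) else -1) • A i) k‖ ^ 2 =
      (∑ k ∈ (Torus.freqBall N).erase 0, ‖m k‖ ^ 2) + ∑ i, ∑ k ∈ (Torus.freqBall N).erase 0, ‖A i k‖ ^ 2 := by
    have h : (Fintype.card (ι → Bool) : ℝ)⁻¹ * ∑ s : ι → Bool, ∑ k ∈ (Torus.freqBall N).erase 0,
        (inner ℂ ((m + ∑ i, (if s i then (1 : ℝ) else -1) • A i) k)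
          ((m + ∑ i, (if s i then (1 : ℝ) else -1) • A i) k)).re =
        (∑ k ∈ (Torus.freqBall N).erase 0, (inner ℂ (m k) (m k)).re) +
          ∑ i, ∑ k ∈ (Torus.freqBall N).erase 0, (inner ℂ (A i k) (A i k)).re := by
      refine average_sign_of_bilinear (fun c c' : (Fin 3 → ℤ) → EuclideanSpace ℂ (Fin 3) =>
          ∑ k ∈ (Torus.freqBall N).erase 0, (inner ℂ (c k) (c' k)).re)
        (fun x y z => ?_) (fun r x z => ?_) (fun x y z => ?_) (fun r x z => ?_) m A
      · exact functional₂_add_left (fun _ v => v) (fun _ v => v) (fun _ _ _ => rfl) x y z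
      · exact functional₂_smul_left (fun _ v => v) (fun _ v => v) (fun _ _ _ => rfl) r x z
      · exact functional₂_add_right (fun _ v => v) (fun _ v => v) (fun _ _ _ => rfl) x y z
      · exact functional₂_smul_right (fun _ v => v) (fun _ v => v) (fun _ _ _ => rfl) r x z
    simpa only [energyForm_diag] using h
  have hLinH : (Fintype.card (ι → Bool) : ℝ)⁻¹ * ∑ s : ι → Bool, ∑ k ∈ (Torus.freqBall N).erase 0,
      (inner ℂ (mFourierCoeff (EuclideanSpace.complexify ∘ f) k)
        (IntermittentBeltrami.curlCoeff (m + ∑ i, (if s i then (1 : ℝ) else -1) • A i) k)).re =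
      ∑ k ∈ (Torus.freqBall N).erase 0, (inner ℂ (mFourierCoeff (EuclideanSpace.complexify ∘ f) k)
        (IntermittentBeltrami.curlCoeff m k)).re := by
    refine average_sign_of_linear (fun c : (Fin 3 → ℤ) → EuclideanSpace ℂ (Fin 3) =>
        ∑ k ∈ (Torus.freqBall N).erase 0, (inner ℂ (mFourierCoeff (EuclideanSpace.complexify ∘ f) k)
          (IntermittentBeltrami.curlCoeff c k)).re)
      (fun x y => ?_) (fun r x => ?_) m A
    · exact functional₁_add (fun k => mFourierCoeff (EuclideanSpace.complexify ∘ f) k)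
        (fun k v => IntermittentBeltrami.curlCoeff (fun _ => v) k) curlCoeff_const_add x y
    · exact functional₁_smul (fun k => mFourierCoeff (EuclideanSpace.complexify ∘ f) k)
        (fun k v => IntermittentBeltrami.curlCoeff (fun _ => v) k) curlCoeff_const_smul r x
  have hHel : (Fintype.card (ι → Bool) : ℝ)⁻¹ * ∑ s : ι → Bool, ∑ k ∈ (Torus.freqBall N).erase 0,
      (inner ℂ ((m + ∑ i, (if s i then (1 : ℝ) else -1) • A i) k)
        (-((((4 * Real.pi ^ 2 * Torus.freqNormSq k : ℝ) : ℂ)) •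
          IntermittentBeltrami.curlCoeff (m + ∑ i, (if s i then (1 : ℝ) else -1) • A i) k))).re =
      (∑ k ∈ (Torus.freqBall N).erase 0, (inner ℂ (m k) (-((((4 * Real.pi ^ 2 * Torus.freqNormSq k : ℝ) : ℂ)) •
          IntermittentBeltrami.curlCoeff m k))).re) +
        ∑ i, ∑ k ∈ (Torus.freqBall N).erase 0, (inner ℂ (A i k) (-((((4 * Real.pi ^ 2 * Torus.freqNormSq k : ℝ) : ℂ)) •
          IntermittentBeltrami.curlCoeff (A i) k))).re := by
    refine average_sign_of_bilinear (fun c c' : (Fin 3 → ℤ) → EuclideanSpace ℂ (Fin 3) =>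
        ∑ k ∈ (Torus.freqBall N).erase 0, (inner ℂ (c k) (-((((4 * Real.pi ^ 2 * Torus.freqNormSq k : ℝ) : ℂ)) •
          IntermittentBeltrami.curlCoeff c' k))).re)
      (fun x y z => ?_) (fun r x z => ?_) (fun x y z => ?_) (fun r x z => ?_) m A
    · exact functional₂_add_left (fun _ v => v)
        (fun k v => -((((4 * Real.pi ^ 2 * Torus.freqNormSq k : ℝ) : ℂ)) • IntermittentBeltrami.curlCoeff (fun _ => v) k))
        (fun _ _ _ => rfl) x y z
    · exact functional₂_smul_left (fun _ v => v)
        (fun k v => -((((4 * Real.pi ^ 2 * Torus.freqNormSq k : ℝ) : ℂ)) • IntermittentBeltrami.curlCoeff (fun _ => v) k))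
        (fun _ _ _ => rfl) r x z
    · exact functional₂_add_right (fun _ v => v)
        (fun k v => -((((4 * Real.pi ^ 2 * Torus.freqNormSq k : ℝ) : ℂ)) • IntermittentBeltrami.curlCoeff (fun _ => v) k))
        (fun k x y => by simp only [curlCoeff_const_add, smul_add, neg_add]) x y z
    · exact functional₂_smul_right (fun _ v => v)
        (fun k v => -((((4 * Real.pi ^ 2 * Torus.freqNormSq k : ℝ) : ℂ)) • IntermittentBeltrami.curlCoeff (fun _ => v) k))
        (fun k r x => by simp only [curlCoeff_const_smul]; rw [smul_comm, smul_neg]) r x z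
  refine ⟨((Fintype.card (ι → Bool) : ℝ≥0∞))⁻¹ • ∑ s, Measure.dirac (U s), isProbabilityMeasure_average U,
    ae_average U fun s => level_of_ae_eq (hU s) (hc s), integrable_average U _, ?_, ?_, ?_, ?_, ?_⟩
  · -- LINEAR ROWS
    intro g hg
    refine ⟨integrable_average U _, ?_⟩
    obtain ⟨hgs, hgd, hgz, hgb⟩ := hg
    rw [MomentParityQuarticGate.integral_average]
    have hrow : ∀ s, Torus.nsGeneratorPairing ν f (U s) g = _ :=
      fun s => nsGeneratorPairing_of_ae_eq (hU s) (hc s) (hcT s) ν f hgs hgb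
    simp_rw [hrow]
    -- the two sign averages
    have h1 : (Fintype.card (ι → Bool) : ℝ)⁻¹ * ∑ s : ι → Bool, ∑ k ∈ (Torus.freqBall N).erase 0,
        (inner ℂ (-((((4 * Real.pi ^ 2 * Torus.freqNormSq k : ℝ) : ℂ)) •
          (m + ∑ i, (if s i then (1 : ℝ) else -1) • A i) k))
          (mFourierCoeff (EuclideanSpace.complexify ∘ g) k)).re =
        ∑ k ∈ (Torus.freqBall N).erase 0,
          (inner ℂ (-((((4 * Real.pi ^ 2 * Torus.freqNormSq k : ℝ) : ℂ)) • m k))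
            (mFourierCoeff (EuclideanSpace.complexify ∘ g) k)).re := by
      refine average_sign_of_linear (fun c : (Fin 3 → ℤ) → EuclideanSpace ℂ (Fin 3) =>
        ∑ k ∈ (Torus.freqBall N).erase 0, (inner ℂ (-((((4 * Real.pi ^ 2 * Torus.freqNormSq k : ℝ) : ℂ)) • c k))
          (mFourierCoeff (EuclideanSpace.complexify ∘ g) k)).re) (fun x y => ?_) (fun r x => ?_) m A
      · rw [← Finset.sum_add_distrib]
        refine Finset.sum_congr rfl fun k _ => ?_
        rw [Pi.add_apply, smul_add, neg_add, inner_add_left, Complex.add_re]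
      · rw [Finset.mul_sum]
        refine Finset.sum_congr rfl fun k _ => ?_
        rw [Pi.smul_apply, smul_comm, ← smul_neg, ← Complex.coe_smul, inner_smul_left, Complex.conj_ofReal,
          Complex.re_ofReal_mul]
    have h2 : (Fintype.card (ι → Bool) : ℝ)⁻¹ * ∑ s : ι → Bool, ∑ k ∈ (Torus.freqBall N).erase 0,
        (inner ℂ (Torus.convectionCoeff ((Torus.freqBall N).erase 0)
          (m + ∑ i, (if s i then (1 : ℝ) else -1) • A i) (m + ∑ i, (if s i then (1 : ℝ) else -1) • A i) k)
          (mFourierCoeff (EuclideanSpace.complexify ∘ g) k)).re =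
        (∑ k ∈ (Torus.freqBall N).erase 0,
          (inner ℂ (Torus.convectionCoeff ((Torus.freqBall N).erase 0) m m k)
            (mFourierCoeff (EuclideanSpace.complexify ∘ g) k)).re) +
        ∑ i, ∑ k ∈ (Torus.freqBall N).erase 0,
          (inner ℂ (Torus.convectionCoeff ((Torus.freqBall N).erase 0) (A i) (A i) k)
            (mFourierCoeff (EuclideanSpace.complexify ∘ g) k)).re := by
      refine average_sign_of_bilinear (fun c c' : (Fin 3 → ℤ) → EuclideanSpace ℂ (Fin 3) =>
        ∑ k ∈ (Torus.freqBall N).erase 0, (inner ℂ (Torus.convectionCoeff ((Torus.freqBall N).erase 0) c c' k)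
            (mFourierCoeff (EuclideanSpace.complexify ∘ g) k)).re)
        (fun x y z => ?_) (fun r x z => ?_) (fun x y z => ?_) (fun r x z => ?_) m A
      · exact stressRow_add_left _ x y z
      · exact stressRow_smul_left _ r x z
      · exact stressRow_add_right _ x y z
      · exact stressRow_smul_right _ r x z
    rw [Finset.sum_sub_distrib, Finset.sum_add_distrib, Finset.sum_const, Finset.card_univ, nsmul_eq_mul,
      ← Finset.mul_sum, mul_sub, mul_add, ← mul_assoc, ← mul_assoc,
      inv_mul_cancel₀ (by exact_mod_cast Fintype.card_ne_zero : (Fintype.card (ι → Bool) : ℝ) ≠ 0), one_mul,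
      mul_comm _ ν, mul_assoc, h1, h2]
    -- the design identities, frequency by frequency
    have hpt : ∀ k ∈ (Torus.freqBall N).erase 0,
        (inner ℂ (mFourierCoeff (EuclideanSpace.complexify ∘ f) k) (mFourierCoeff (EuclideanSpace.complexify ∘ g) k)).re +
          ν * (inner ℂ (-((((4 * Real.pi ^ 2 * Torus.freqNormSq k : ℝ) : ℂ)) • m k))
            (mFourierCoeff (EuclideanSpace.complexify ∘ g) k)).re -
          ∑ i, (inner ℂ (Torus.convectionCoeff ((Torus.freqBall N).erase 0) (A i) (A i) k)
            (mFourierCoeff (EuclideanSpace.complexify ∘ g) k)).re = 0 := by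
      intro k hk
      rw [← Complex.re_sum, ← sum_inner, hlin k hk, inner_sub_left, inner_neg_left, inner_smul_left,
        inner_smul_left, ← Complex.ofReal_mul, Complex.conj_ofReal, Complex.conj_ofReal, Complex.sub_re,
        Complex.neg_re, Complex.re_ofReal_mul, Complex.re_ofReal_mul]
      ring
    have hmm0 : ∀ k, Torus.convectionCoeff ((Torus.freqBall N).erase 0) m m k = 0 := fun k => by
      rw [hmm]; rfl
    simp_rw [hmm0, inner_zero_left, Complex.zero_re, Finset.sum_const_zero, zero_add]
    rw [Torus.integral_inner_eq_sum_of_band_limited (hf.memLp 2) (hgs.memLp 2) hgb, Finset.mul_sum,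
      ← Finset.sum_add_distrib, Finset.sum_comm, ← Finset.sum_sub_distrib]
    exact Finset.sum_eq_zero hpt
  · -- ENERGY ROW
    refine ⟨integrable_average U _, ?_⟩
    rw [MomentParityQuarticGate.integral_average]
    have hrow : ∀ s, Torus.nsGeneratorPairing ν f (U s)
        (Torus.fourierTruncate N (((U s : H3) : L2T3) : T3 → R3)) = _ :=
      fun s => nsGeneratorPairing_fourierTruncate_of_ae_eq (hU s) (hc s) (hcT s) ν hfi
    simp_rw [hrow]
    rw [Finset.sum_sub_distrib, ← Finset.mul_sum, ← Finset.mul_sum, mul_sub, hLinE, mul_left_comm, mul_left_comm _ (4 * Real.pi ^ 2),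
      hZ]
  · -- HELICITY ROW
    refine ⟨integrable_average U _, ?_⟩
    rw [MomentParityQuarticGate.integral_average]
    have hrow : ∀ s, Torus.nsGeneratorPairing ν f (U s)
        (BDSV.curl (Torus.fourierTruncate N (((U s : H3) : L2T3) : T3 → R3))) = _ :=
      fun s => nsGeneratorPairing_curl_fourierTruncate_of_ae_eq (hU s) (hc s) (hcT s) ν hfi
    simp_rw [hrow]
    rw [Finset.sum_add_distrib, ← Finset.mul_sum, mul_add, hLinH, mul_left_comm, hHel]
  · -- ENERGY
    rw [ensembleEnergy_average]
    simp_rw [fun s => norm_sq_of_ae_eq (hU s) (hc s)]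
    exact hEn
  · -- DISSIPATION
    rw [ensembleDissipation_average U ν (e := fun s => 4 * Real.pi ^ 2 * ∑ k ∈ (Torus.freqBall N).erase 0,
        Torus.freqNormSq k * ‖(m + ∑ i, (if s i then (1 : ℝ) else -1) • A i) k‖ ^ 2)
        (fun s => mul_nonneg (by positivity) (Finset.sum_nonneg fun k _ =>
          mul_nonneg (Torus.freqNormSq_nonneg k) (sq_nonneg _)))
        (fun s => eGradNormSq_of_ae_eq (hU s) (hc s))]
    rw [← Finset.mul_sum, mul_left_comm ((Fintype.card (ι → Bool) : ℝ)⁻¹) (4 * Real.pi ^ 2), hZ]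

end Atoms

/-- **Registered sub-goal `balancedMenu_atomCloud` of stub S5 `stub_balancedMenu`** (summary of this
file): the uniform law on the random-sign atom cloud and all its rows. [folklore] -/
theorem balancedMenu_atomCloud : ∀ (ι : Type) [Fintype ι] [DecidableEq ι] (N : ℕ) (ν : ℝ) (f : T3 → R3) (m : (Fin 3 → ℤ) → EuclideanSpace ℂ (Fin 3)) (A : ι → (Fin 3 → ℤ) → EuclideanSpace ℂ (Fin 3)), Torus.IsSmooth f → Torus.IsConjSymm m → Torus.IsTransversal ((Torus.freqBall N).erase 0) m → (∀ i, Torus.IsConjSymm (A i)) → (∀ i, Torus.IsTransversal ((Torus.freqBall N).erase 0) (A i)) → Torus.convectionCoeff ((Torus.freqBall N).erase 0) m m = 0 → (∀ κ ∈ (Torus.freqBall N).erase 0, ∑ i, Torus.convectionCoeff ((Torus.freqBall N).erase 0) (A i) (A i) κ = mFourierCoeff (EuclideanSpace.complexify ∘ f) κ - (((4 * Real.pi ^ 2 * Torus.freqNormSq κ : ℝ) : ℂ) * (ν : ℂ)) • m κ) → ∃ μ : Measure H3, IsProbabilityMeasure μ ∧ (∀ᵐ u ∂μ, IsLevel N u)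 ∧ Integrable (fun u : H3 => ‖u‖ ^ 3) μ ∧ (∀ g : T3 → R3, IsBandTest N g → Integrable (fun u : H3 => Torus.nsGeneratorPairing ν f u g) μ ∧ ∫ u, Torus.nsGeneratorPairing ν f u g ∂μ = 0) ∧ (Integrable (fun u : H3 => Torus.nsGeneratorPairing ν f u (Torus.fourierTruncate N ((u : L2T3) : T3 → R3))) μ ∧ ∫ u, Torus.nsGeneratorPairing ν f u (Torus.fourierTruncate N ((u : L2T3) : T3 → R3)) ∂μ = (∑ κ ∈ (Torus.freqBall N).erase 0, (inner ℂ (mFourierCoeff (EuclideanSpace.complexify ∘ f) κ) (m κ)).re) - ν * (4 * Real.pi ^ 2 * ((∑ κ ∈ (Torus.freqBall N).erase 0, Torus.freqNormSq κ * ‖m κ‖ ^ 2) + ∑ i, ∑ κ ∈ (Torus.freqBall N).erase 0, Torus.freqNormSq κ * ‖A i κ‖ ^ 2))) ∧ (Integrable (fun u : H3 => Torus.nsGeneratorPairing ν f u (BDSV.curl (Torus.fourierTruncate N ((u : L2T3) : T3 → R3)))) μ ∧ ∫ u, Torus.nsGeneratorPairing ν f u (BDSV.curl (Torus.fourierTruncate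 N ((u : L2T3) : T3 → R3))) ∂μ = (∑ κ ∈ (Torus.freqBall N).erase 0, (inner ℂ (mFourierCoeff (EuclideanSpace.complexify ∘ f) κ) (IntermittentBeltrami.curlCoeff m κ)).re) + ν * ((∑ κ ∈ (Torus.freqBall N).erase 0, (inner ℂ (m κ) (-((((4 * Real.pi ^ 2 * Torus.freqNormSq κ : ℝ) : ℂ)) • IntermittentBeltrami.curlCoeff m κ))).re) + ∑ i, ∑ κ ∈ (Torus.freqBall N).erase 0, (inner ℂ (A i κ) (-((((4 * Real.pi ^ 2 * Torus.freqNormSq κ : ℝ) : ℂ)) • IntermittentBeltrami.curlCoeff (A i) κ))).re)) ∧ Torus.ensembleEnergy μ = (∑ κ ∈ (Torus.freqBall N).erase 0, ‖m κ‖ ^ 2) + ∑ i, ∑ κ ∈ (Torus.freqBall N).erase 0, ‖A i κ‖ ^ 2 ∧ Torus.ensembleDissipation ν μ = ν * (4 * Real.pi ^ 2 * ((∑ κ ∈ (Torus.freqBall N).erase 0, Torus.freqNormSq κ * ‖m κ‖ ^ 2) + ∑ i, ∑ κ ∈ (Torus.freqBall N).erase 0, Torus.freqNormSq κ * ‖A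 i κ‖ ^ 2)) :=
  fun _ _ _ N ν _ m A hf hm hmT hA hAT hmm hlin => atoms_measure N ν hf m A hm hmT hA hAT hmm hlin

end Summit.AnomalousDissipation.AnomalousDissipation.Theorems.MomentParityCubicParityLoud

end
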